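import Summits.CriticalPhenomena.PercolationContinuityZ3.Theorems.PercNearOneGluingNoHeavyQuantIndepBlobGapCalculus
import HarnessLib

/-!
# QUANT lane R8, Conjecture DIB\* — BIG CARRIERS: the value of the largest open big light (the star of `…BigLights` made monotone),
# part (X) of the cloud series

builds on p205010 (kernel theorem, internal audit signed; external expert review pending)

Support file (`--supports stmt-CriticalPhenomena-4575`), QUANT lane census seat prim-quant-census-1 (gen 16), rung R8 of
`run/shared/lean/prim/quant/LADDER.md`; memo `run/shared/lean/prim/quant/prim-quant-census-1/TRUNCATED-MEAN-G16.md` §4.  Theorems only,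
no definitions, no sorries, standard axioms; restricted weights `w_B(S) = Π_{k ∈ B}(p k | 1 − p k)` as in `…QuantIndepBlobGapCalculus`.

SETTING.  Shortfall `Cp > 0`, floor `0 < x < 1`.  A BIG light has size `b ≥ Cp/x`; the LIGHT ROUTE of `…BigLights` carries the empty
outcome on an outcome of mass `h ≤ j` through the one-light component `(0, h, γ)`, `γ > γ*(h) = x² + (1 − x)Cp/h`, worth
`ℓ(h) := 1/γ*(h) = h/(x²h + (1 − x)Cp)` per unit of mass.  For a finset `B` of big lights let
`E_B := Σ_{S ⊆ B, S ≠ ∅} w_B(S)·ℓ(max_{k ∈ S} a k)` (the value of the LARGEST open big light; `0` if none is open), `Q_B = Π_B(1 − p)`,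
`β = C_B/Cp`, `C_B = Σ_B a·κ_x(p)`.

* `Quant.IndepBlob.bigLight_value` — ONE big light: `(1 − g)·min(K/Cp, 1) ≤ g·(ℓ(b) − 1)` (`K(1 − x) = b(g − x²)` its credit), by the
  identity `b·[g b Cp − g Cp D − (1 − g)K D] = (1 − x)(Cp − K)(x²(1 + x)b² − x²Cp·b − K·D)`, `D = x²b + (1 − x)Cp`, and
  `x²(1+x)b² − 2x²Cp b − (1−x)Cp² = (xb − Cp)((1+x)xb + (1−x)Cp) ≥ 0`; `one_lt_bigLight_value`: `K > Cp ⟹ g ℓ(b) > 1` (= `…BigLights`' one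
  light).
* **`Quant.IndepBlob.bigCloud_value`** — `E_B ≥ 1 − max(0, 1 − β)·Q_B`, and `E_B > 1` when `β > 1` (induction on `B`, inserting the largest
  light: `E_B = p ℓ(a) + (1 − p) E_{B'}`).
* `Quant.IndepBlob.sum_powerset_weight_union_mul` — independence of two disjoint sub-clouds:
  `Σ_{S ⊆ B ∪ M} w(S) F(S ∩ B) G(S ∩ M) = (Σ_{T ⊆ B} w_B F)(Σ_{S' ⊆ M} w_M G)`.
Part (XI) `…HalfShortfall` combines `E_B` with the truncated mean of the medium lights (parts VII–IX) into Conjecture DIB\* for every cloud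
whose lights all exceed half the shortfall.

[this work; this lane's census]; the gluing rows served: [cite: KozmaNitzan2024, Conjecture 3 (p. 15)]; product weights
[cite: Grimmett1999, §1.3 p. 10].
-/

namespace Summit.CriticalPhenomena.PercolationContinuityZ3.Theorems

namespace Quant

namespace IndepBlob

open Finset

variable {κ : Type*} [DecidableEq κ]

/-- restricted product weight of the outcome `S` of the cloud `L` -/
local notation3 "wL[" p ", " L ", " S "]" =>
  ∏ k ∈ (L : Finset κ), (if k ∈ (S : Finset κ) then (p : κ → ℝ) k else 1 - (p : κ → ℝ) k)

/-! ### 19. One big light -/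

/-- **The value of one big light.**  `0 < x < 1`, `0 < Cp ≤ x·b`, gate `g` with credit `K(1 − x) = b(g − x²)`:
`(1 − g)·min(K/Cp, 1) ≤ g·(b/(x²b + (1 − x)Cp) − 1)`. [this work] -/
theorem bigLight_value (x Cp b g K : ℝ) (hx0 : 0 < x) (hx1 : x < 1) (hCp : 0 < Cp) (hb : Cp ≤ x * b)
    (hK : K * (1 - x) = b * (g - x ^ 2)) :
    (1 - g) * min (K / Cp) 1 ≤ g * (b / (x ^ 2 * b + (1 - x) * Cp) - 1) := by
  have h1x : 0 < 1 - x := by linarith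
  have hbpos : 0 < b := by nlinarith
  set D : ℝ := x ^ 2 * b + (1 - x) * Cp with hD
  have hDpos : 0 < D := by positivity
  have hgb : g * b = K * (1 - x) + x ^ 2 * b := by linarith
  rcases le_or_gt K Cp with hKC | hKC
  · rw [min_eq_left ((div_le_one hCp).2 hKC)]
    -- `val := g b Cp − g Cp D − (1 − g) K D ≥ 0`
    have hid : b * (g * b * Cp - g * Cp * D - (1 - g) * K * D) =
        (1 - x) * (Cp - K) * (x ^ 2 * (1 + x) * b ^ 2 - x ^ 2 * Cp * b - K * D) := by
      rw [hD]; linear_combination (-(b * Cp - Cp * (x ^ 2 * b + (1 - x) * Cp) + K * (x ^ 2 * b + (1 - x) * Cp)) + 0) * hK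
    have hbr : 0 ≤ x ^ 2 * (1 + x) * b ^ 2 - x ^ 2 * Cp * b - K * D := by
      have h1 : K * D ≤ Cp * D := mul_le_mul_of_nonneg_right hKC hDpos.le
      have h2 : x ^ 2 * (1 + x) * b ^ 2 - x ^ 2 * Cp * b - Cp * D = (x * b - Cp) * ((1 + x) * (x * b) + (1 - x) * Cp) := by
        rw [hD]; ring
      have h3 : 0 ≤ (x * b - Cp) * ((1 + x) * (x * b) + (1 - x) * Cp) :=
        mul_nonneg (by linarith) (by positivity)
      linarith
    have hval : 0 ≤ g * b * Cp - g * Cp * D - (1 - g) * K * D := by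
      have : 0 ≤ b * (g * b * Cp - g * Cp * D - (1 - g) * K * D) := by
        rw [hid]; exact mul_nonneg (mul_nonneg h1x.le (by linarith)) hbr
      nlinarith
    -- divide by `Cp·D`
    have e : g * (b / D - 1) = (g * b - g * D) / D := by field_simp
    rw [e, mul_div_assoc', div_le_div_iff₀ hCp hDpos]
    nlinarith
  · rw [min_eq_right ((one_le_div hCp).2 hKC.le), mul_one]
    have hDle : D ≤ g * b := by rw [hgb, hD]; nlinarith
    have e : g * (b / D - 1) = (g * b - g * D) / D := by field_simp
    rw [e, le_div_iff₀ hDpos]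
    nlinarith

/-- Strict form: credit `K > Cp` ⟹ `g·ℓ(b) > 1` (the one-light condition of `…BigLights`). [this work] -/
theorem one_lt_bigLight_value (x Cp b g K : ℝ) (hx0 : 0 < x) (hx1 : x < 1) (hCp : 0 < Cp) (hb : Cp ≤ x * b)
    (hK : K * (1 - x) = b * (g - x ^ 2)) (hKC : Cp < K) : 1 < g * (b / (x ^ 2 * b + (1 - x) * Cp)) := by
  have h1x : 0 < 1 - x := by linarith
  have hbpos : 0 < b := by nlinarith
  have hDpos : 0 < x ^ 2 * b + (1 - x) * Cp := by positivity
  have hgb : g * b = K * (1 - x) + x ^ 2 * b := by linarith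
  rw [mul_div_assoc', one_lt_div hDpos, hgb]
  nlinarith

/-- `ℓ(b) ≥ 1` for `b ≥ Cp/x` (indeed for `b ≥ Cp/(1 + x)`). [this work] -/
theorem one_le_bigLight_ell (x Cp b : ℝ) (hx0 : 0 < x) (hx1 : x < 1) (hCp : 0 < Cp) (hb : Cp ≤ x * b) :
    1 ≤ b / (x ^ 2 * b + (1 - x) * Cp) := by
  have hbpos : 0 < b := by nlinarith
  have hDpos : 0 < x ^ 2 * b + (1 - x) * Cp := by nlinarith
  rw [one_le_div hDpos]
  nlinarith

/-! ### 20. The value of the largest open big light -/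

/-- Independence of disjoint sub-clouds: for `F` of the `B`-part and `G` of the `M`-part of an outcome,
`Σ_{S ⊆ B ∪ M} w_{B∪M}(S)·F(S ∩ B)·G(S ∩ M) = (Σ_{T ⊆ B} w_B(T) F(T))·(Σ_{S' ⊆ M} w_M(S') G(S'))`. [folklore] -/
theorem sum_powerset_weight_union_mul (p : κ → ℝ) (B M : Finset κ) (hBM : Disjoint B M) (F G : Finset κ → ℝ) :
    ∑ S ∈ (B ∪ M).powerset, wL[p, B ∪ M, S] * (F (S ∩ B) * G (S ∩ M)) =
      (∑ T ∈ B.powerset, wL[p, B, T] * F T) * (∑ S' ∈ M.powerset, wL[p, M, S'] * G S') := by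
  induction M using Finset.induction_on generalizing G with
  | empty =>
    simp only [Finset.union_empty, Finset.powerset_empty, Finset.sum_singleton, Finset.prod_empty, Finset.inter_empty, mul_comm]
    rw [Finset.mul_sum]
    refine Finset.sum_congr rfl fun T hT => ?_
    rw [Finset.inter_eq_left.2 (Finset.mem_powerset.1 hT)]; ring
  | @insert m M hm ih =>
    have hmB : m ∉ B := fun h => (Finset.disjoint_left.1 hBM h) (Finset.mem_insert_self m M)
    have hBM' : Disjoint B M := Finset.disjoint_of_subset_right (Finset.subset_insert m M) hBM
    have hmBM : m ∉ B ∪ M := by simp [hmB, hm]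
    rw [Finset.union_insert, sum_powerset_weight_insert p (B ∪ M) m hmBM, sum_powerset_weight_insert p M m hm]
    have e1 : ∀ S ∈ (B ∪ M).powerset, wL[p, B ∪ M, S] * (F (insert m S ∩ B) * G (insert m S ∩ insert m M)) =
        wL[p, B ∪ M, S] * (F (S ∩ B) * (G ∘ insert m) (S ∩ M)) := by
      intro S hS
      have hmS : m ∉ S := fun h => hmBM (Finset.mem_powerset.1 hS h)
      rw [Finset.insert_inter_of_notMem hmB, Finset.insert_inter_of_mem (Finset.mem_insert_self m M),
        Finset.inter_insert_of_notMem hmS]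
      rfl
    have e2 : ∀ S ∈ (B ∪ M).powerset, wL[p, B ∪ M, S] * (F (S ∩ B) * G (S ∩ insert m M)) =
        wL[p, B ∪ M, S] * (F (S ∩ B) * G (S ∩ M)) := by
      intro S hS
      have hmS : m ∉ S := fun h => hmBM (Finset.mem_powerset.1 hS h)
      rw [Finset.inter_insert_of_notMem hmS]
    rw [Finset.sum_congr rfl e1, Finset.sum_congr rfl e2, ih hBM' (G ∘ insert m), ih hBM' G]
    simp only [Function.comp]
    ring

/-- **THE VALUE OF THE LARGEST OPEN BIG LIGHT.**  `0 < x < 1`, `0 < Cp`; a finset `B` of big lights (`Cp ≤ x·a k`, gates in `[0, 1)`);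
`E_B := Σ_{S ⊆ B} w_B(S)·[S ≠ ∅]·ℓ(max_S a)`, `ℓ(h) = h/(x²h + (1 − x)Cp)`, `Q_B = Π_B (1 − p)`, `C_B = Σ_B a·(p − x²)/(1 − x)`:
**`1 − max(0, 1 − C_B/Cp)·Q_B ≤ E_B`, `1 < E_B` when `Cp < C_B`, and `1 − Q_B ≤ E_B`.** [this work] -/
theorem bigCloud_value (p : κ → ℝ) (a : κ → ℕ) (x Cp : ℝ) (hx0 : 0 < x) (hx1 : x < 1) (hCp : 0 < Cp) :
    ∀ (n : ℕ) (B : Finset κ), B.card = n → (∀ k ∈ B, 0 ≤ p k ∧ p k < 1) → (∀ k ∈ B, Cp ≤ x * (a k : ℝ)) →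
      1 - max 0 (1 - (∑ k ∈ B, (a k : ℝ) * ((p k - x ^ 2) / (1 - x))) / Cp) * ∏ k ∈ B, (1 - p k) ≤
          ∑ S ∈ B.powerset, wL[p, B, S] *
            (if S = ∅ then (0 : ℝ) else ((S.sup a : ℕ) : ℝ) / (x ^ 2 * ((S.sup a : ℕ) : ℝ) + (1 - x) * Cp)) ∧
        (Cp < ∑ k ∈ B, (a k : ℝ) * ((p k - x ^ 2) / (1 - x)) →
          1 < ∑ S ∈ B.powerset, wL[p, B, S] *
            (if S = ∅ then (0 : ℝ) else ((S.sup a : ℕ) : ℝ) / (x ^ 2 * ((S.sup a : ℕ) : ℝ) + (1 - x) * Cp))) ∧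
        1 - ∏ k ∈ B, (1 - p k) ≤ ∑ S ∈ B.powerset, wL[p, B, S] *
            (if S = ∅ then (0 : ℝ) else ((S.sup a : ℕ) : ℝ) / (x ^ 2 * ((S.sup a : ℕ) : ℝ) + (1 - x) * Cp)) := by
  have h1x : 0 < 1 - x := by linarith
  intro n
  induction n using Nat.strong_induction_on with
  | _ n ih =>
  intro B hcard hp hbig
  -- the value function and its sign
  set V : Finset κ → ℝ := fun S =>
    if S = ∅ then (0 : ℝ) else ((S.sup a : ℕ) : ℝ) / (x ^ 2 * ((S.sup a : ℕ) : ℝ) + (1 - x) * Cp) with hV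
  have hV0 : ∀ S, 0 ≤ V S := by
    intro S; simp only [hV]
    split_ifs
    · exact le_rfl
    · exact div_nonneg (Nat.cast_nonneg _) (by positivity)
  have hE0 : ∀ (B : Finset κ), (∀ k ∈ B, 0 ≤ p k ∧ p k < 1) → 0 ≤ ∑ S ∈ B.powerset, wL[p, B, S] * V S :=
    fun B hp => Finset.sum_nonneg fun S _ =>
      mul_nonneg (weightU_nonneg p B (fun k hk => (hp k hk).1) (fun k hk => (hp k hk).2.le) S) (hV0 S)
  change 1 - max 0 (1 - (∑ k ∈ B, (a k : ℝ) * ((p k - x ^ 2) / (1 - x))) / Cp) * ∏ k ∈ B, (1 - p k) ≤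
      ∑ S ∈ B.powerset, wL[p, B, S] * V S ∧
    (Cp < ∑ k ∈ B, (a k : ℝ) * ((p k - x ^ 2) / (1 - x)) → 1 < ∑ S ∈ B.powerset, wL[p, B, S] * V S) ∧
    1 - ∏ k ∈ B, (1 - p k) ≤ ∑ S ∈ B.powerset, wL[p, B, S] * V S
  rcases B.eq_empty_or_nonempty with hB0 | hne
  · subst hB0
    simp only [Finset.sum_empty, Finset.powerset_empty, Finset.sum_singleton, Finset.prod_empty, zero_div, sub_zero,
      max_eq_right zero_le_one, mul_one, sub_self]
    refine ⟨?_, fun h => absurd h (not_lt.2 hCp.le), ?_⟩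
    · simp [hV]
    · simp [hV]
  -- the largest light `k`
  obtain ⟨k, hkB, hmax⟩ := Finset.exists_max_image B a hne
  set B' : Finset κ := B.erase k with hB'def
  have hB : B = insert k B' := (Finset.insert_erase hkB).symm
  have hkB' : k ∉ B' := Finset.notMem_erase k B
  have hsub : ∀ i ∈ B', i ∈ B := fun i hi => Finset.mem_of_mem_erase hi
  have hcard' : B'.card = n - 1 := by rw [hB'def, Finset.card_erase_of_mem hkB, hcard]
  have hn : 1 ≤ n := by rw [← hcard]; exact Finset.card_pos.2 hne
  have IH := ih (n - 1) (by omega) B' hcard' (fun i hi => hp i (hsub i hi)) (fun i hi => hbig i (hsub i hi))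
  -- `E_B = p k·ℓ(a k) + (1 − p k)·E_{B'}`
  set ℓk : ℝ := (a k : ℝ) / (x ^ 2 * (a k : ℝ) + (1 - x) * Cp) with hℓk
  have hVins : ∀ S ∈ B'.powerset, V (insert k S) = ℓk := by
    intro S hS
    have hsup : (insert k S).sup a = a k := by
      rw [Finset.sup_insert]
      exact sup_eq_left.2 (Finset.sup_le fun i hi => hmax i (hsub i (Finset.mem_powerset.1 hS hi)))
    simp only [hV, if_neg (Finset.insert_ne_empty k S), hsup, hℓk]
  have hE : ∑ S ∈ B.powerset, wL[p, B, S] * V S = p k * ℓk + (1 - p k) * ∑ S ∈ B'.powerset, wL[p, B', S] * V S := by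
    rw [hB, sum_powerset_weight_insert p B' k hkB' V, Finset.sum_congr rfl (fun S hS => by rw [hVins S hS]),
      ← Finset.sum_mul, sum_powerset_weight, one_mul]
  have hC : ∑ i ∈ B, (a i : ℝ) * ((p i - x ^ 2) / (1 - x)) =
      (a k : ℝ) * ((p k - x ^ 2) / (1 - x)) + ∑ i ∈ B', (a i : ℝ) * ((p i - x ^ 2) / (1 - x)) := by
    rw [hB, Finset.sum_insert hkB']
  have hQ : ∏ i ∈ B, (1 - p i) = (1 - p k) * ∏ i ∈ B', (1 - p i) := by rw [hB, Finset.prod_insert hkB']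
  set E' := ∑ S ∈ B'.powerset, wL[p, B', S] * V S with hE'
  set C' := ∑ i ∈ B', (a i : ℝ) * ((p i - x ^ 2) / (1 - x)) with hC'def
  set Q' := ∏ i ∈ B', (1 - p i) with hQ'
  set Kk : ℝ := (a k : ℝ) * ((p k - x ^ 2) / (1 - x)) with hKk
  have hKk' : Kk * (1 - x) = (a k : ℝ) * (p k - x ^ 2) := by rw [hKk, mul_assoc, div_mul_cancel₀ _ h1x.ne']
  have hpk := hp k hkB
  have hqk : 0 < 1 - p k := by linarith [hpk.2]
  have hQ'0 : 0 ≤ Q' := Finset.prod_nonneg fun i hi => by linarith [(hp i (hsub i hi)).2]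
  have hQ'1 : Q' ≤ 1 := Finset.prod_le_one (fun i hi => by linarith [(hp i (hsub i hi)).2]) (fun i hi => by linarith [(hp i (hsub i hi)).1])
  have hE'0 : 0 ≤ E' := hE0 B' (fun i hi => hp i (hsub i hi))
  have hℓ1 : 1 ≤ ℓk := one_le_bigLight_ell x Cp (a k) hx0 hx1 hCp (hbig k hkB)
  have hval : (1 - p k) * min (Kk / Cp) 1 ≤ p k * (ℓk - 1) :=
    bigLight_value x Cp (a k) (p k) Kk hx0 hx1 hCp (hbig k hkB) hKk'
  rw [hE, hC, hQ]
  -- `m(y) = max(0, 1 − y/Cp)` is nonincreasing and `1/Cp`-Lipschitz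
  have hm_mono : ∀ y z : ℝ, y ≤ z → max 0 (1 - z / Cp) ≤ max 0 (1 - y / Cp) := fun y z h =>
    max_le_max le_rfl (by have := div_le_div_of_nonneg_right h hCp.le; linarith)
  have hm_lip : ∀ y z : ℝ, y ≤ z → max 0 (1 - y / Cp) - max 0 (1 - z / Cp) ≤ (z - y) / Cp := by
    intro y z h
    have e : (z - y) / Cp = z / Cp - y / Cp := sub_div _ _ _
    rw [e]
    rcases le_or_gt 0 (1 - z / Cp) with h1 | h1
    · rw [max_eq_right h1, max_eq_right (by have := div_le_div_of_nonneg_right h hCp.le; linarith)]; linarith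
    · rw [max_eq_left h1.le]
      have : max 0 (1 - y / Cp) ≤ max 0 (z / Cp - y / Cp) := max_le_max le_rfl (by linarith)
      linarith [max_eq_right (show (0:ℝ) ≤ z / Cp - y / Cp by have := div_le_div_of_nonneg_right h hCp.le; linarith)]
  have hm0 : ∀ y : ℝ, 0 ≤ max 0 (1 - y / Cp) := fun y => le_max_left _ _
  have hthird : 1 - (1 - p k) * Q' ≤ p k * ℓk + (1 - p k) * E' := by
    have h1 : p k * 1 ≤ p k * ℓk := mul_le_mul_of_nonneg_left hℓ1 hpk.1
    have h2 : (1 - p k) * (1 - Q') ≤ (1 - p k) * E' := mul_le_mul_of_nonneg_left IH.2.2 hqk.le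
    linarith
  rcases lt_or_ge Kk 0 with hKneg | hK0'
  · -- a junk big light: `ℓ ≥ 1` and the credit only grows without it
    have hle : max 0 (1 - C' / Cp) ≤ max 0 (1 - (Kk + C') / Cp) := hm_mono _ _ (by linarith)
    refine ⟨?_, ?_, hthird⟩
    · have h1 : p k * 1 ≤ p k * ℓk := mul_le_mul_of_nonneg_left hℓ1 hpk.1
      have h2 : (1 - p k) * (1 - max 0 (1 - C' / Cp) * Q') ≤ (1 - p k) * E' := mul_le_mul_of_nonneg_left IH.1 hqk.le
      have h3 : (1 - p k) * (max 0 (1 - C' / Cp) * Q') ≤ (1 - p k) * (max 0 (1 - (Kk + C') / Cp) * Q') :=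
        mul_le_mul_of_nonneg_left (mul_le_mul_of_nonneg_right hle hQ'0) hqk.le
      linarith
    · intro hC
      have hE' : 1 < E' := IH.2.1 (by linarith)
      have h1 : p k * 1 ≤ p k * ℓk := mul_le_mul_of_nonneg_left hℓ1 hpk.1
      have h2 : (1 - p k) * 1 < (1 - p k) * E' := mul_lt_mul_of_pos_left hE' hqk
      linarith
  rcases le_or_gt Kk Cp with hKC | hKC
  · -- `0 ≤ K ≤ Cp`: the one-light value pays `(1 − p)·K/Cp`
    have hval' : (1 - p k) * (Kk / Cp) ≤ p k * (ℓk - 1) := by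
      rw [← min_eq_left ((div_le_one hCp).2 hKC)]; exact hval
    have hlip := hm_lip C' (Kk + C') (by linarith)
    have hlip' : max 0 (1 - C' / Cp) - max 0 (1 - (Kk + C') / Cp) ≤ Kk / Cp := by
      have : (Kk + C' - C') / Cp = Kk / Cp := by ring_nf
      linarith [this ▸ hlip]
    refine ⟨?_, ?_, hthird⟩
    · have h2 : (1 - p k) * (1 - max 0 (1 - C' / Cp) * Q') ≤ (1 - p k) * E' := mul_le_mul_of_nonneg_left IH.1 hqk.le
      -- `Q'·(m(β') − m(β)) ≤ K/Cp`
      have h3 : Q' * (max 0 (1 - C' / Cp) - max 0 (1 - (Kk + C') / Cp)) ≤ 1 * (Kk / Cp) := by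
        rcases le_or_gt 0 (max 0 (1 - C' / Cp) - max 0 (1 - (Kk + C') / Cp)) with hs | hs
        · exact mul_le_mul hQ'1 hlip' hs zero_le_one
        · have : Q' * (max 0 (1 - C' / Cp) - max 0 (1 - (Kk + C') / Cp)) ≤ 0 := mul_nonpos_of_nonneg_of_nonpos hQ'0 hs.le
          linarith [div_nonneg hK0' hCp.le]
      have h4 : (1 - p k) * (Q' * (max 0 (1 - C' / Cp) - max 0 (1 - (Kk + C') / Cp))) ≤ (1 - p k) * (Kk / Cp) :=
        mul_le_mul_of_nonneg_left (by linarith) hqk.le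
      linarith
    · intro hC
      rcases le_or_gt Cp C' with hC' | hC'
      · -- the rest already has credit `≥ Cp`
        rcases hK0'.lt_or_eq with hKp | hKz
        · have hmz : max 0 (1 - C' / Cp) = 0 := max_eq_left (by rw [sub_nonpos, one_le_div hCp]; exact hC')
          have h2 : (1 - p k) * (1 - max 0 (1 - C' / Cp) * Q') ≤ (1 - p k) * E' := mul_le_mul_of_nonneg_left IH.1 hqk.le
          rw [hmz, zero_mul, sub_zero] at h2
          have : 0 < (1 - p k) * (Kk / Cp) := mul_pos hqk (div_pos hKp hCp)
          linarith
        · -- `K = 0`: the rest has credit `> Cp`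
          have hE' : 1 < E' := IH.2.1 (by rw [← hKz] at hC; linarith)
          have h1 : p k * 1 ≤ p k * ℓk := mul_le_mul_of_nonneg_left hℓ1 hpk.1
          have h2 : (1 - p k) * 1 < (1 - p k) * E' := mul_lt_mul_of_pos_left hE' hqk
          linarith
      · have hmeq : max 0 (1 - C' / Cp) = 1 - C' / Cp := max_eq_right (by rw [sub_nonneg, div_le_one hCp]; exact hC'.le)
        have h2 : (1 - p k) * (1 - max 0 (1 - C' / Cp) * Q') ≤ (1 - p k) * E' := mul_le_mul_of_nonneg_left IH.1 hqk.le
        rw [hmeq] at h2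
        -- `K/Cp − (1 − C'/Cp)·Q' ≥ K/Cp − (1 − C'/Cp) = (K + C' − Cp)/Cp > 0`
        have h3 : (1 - C' / Cp) * Q' ≤ (1 - C' / Cp) * 1 := mul_le_mul_of_nonneg_left hQ'1 (by rw [sub_nonneg, div_le_one hCp]; exact hC'.le)
        have h4 : 0 < Kk / Cp - (1 - C' / Cp) := by
          have : Kk / Cp - (1 - C' / Cp) = (Kk + C' - Cp) / Cp := by field_simp; ring
          rw [this]; exact div_pos (by linarith) hCp
        have h5 : 0 < (1 - p k) * (Kk / Cp - (1 - C' / Cp) * Q') := mul_pos hqk (by linarith)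
        linarith
  · -- `K > Cp`: this light alone is worth more than `1`
    have hgt : 1 < p k * ℓk := one_lt_bigLight_value x Cp (a k) (p k) Kk hx0 hx1 hCp (hbig k hkB) hKk' hKC
    have h2 : 0 ≤ (1 - p k) * E' := mul_nonneg hqk.le hE'0
    have h3 : 0 ≤ max 0 (1 - (Kk + C') / Cp) * ((1 - p k) * Q') := mul_nonneg (hm0 _) (mul_nonneg hqk.le hQ'0)
    exact ⟨by linarith, fun _ => by linarith, hthird⟩

end IndepBlob

end Quant

end Summit.CriticalPhenomena.PercolationContinuityZ3.Theorems
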